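import Summits.CriticalPhenomena.PercolationContinuityZ3.Theorems.PercNearOneGluingNoHeavyLowerTailSunflowerChainOnePetalEdges
import Summits.CriticalPhenomena.PercolationContinuityZ3.Theorems.PercNearOneGluingNoHeavyLowerTailSunflowerPowerCertificate

/-!
# The CHAIN CERTIFICATE for (RES0′): the one-petal theorem `chain_one_petal_of` and (RES0′) FOR EVERY NUMBER OF PETALS (`res0_of_chain_certificate`)

(prove-1 gen 56, memo run/shared/lean/prim/prim-ineq-prove-1/FINDING-CHAIN-prove1-g56.md §1–§3; see part 1
`…SunflowerChainOnePetalEdges` for the model, the chain equations and the kink-dwarf hypotheses (Da), (Db), (Dc).)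
This file finishes the vertex reduction: the two faces `g = k` and `g = h` of the petal polytope (interpolating the edge and diagonal
lemmas of part 1 in `k`, resp. `h`), the interpolation in `y`, and the monotone elimination of the unpriced cell `g`, giving
**`chain_one_petal_of`**: every petal satisfies `G(y,k,g,h) ≤ g·(y/α₀₀)^λ_y·(k/α₀₁)^λ_k·(h/α₁₁)^λ_h`.
Then **`res0_of_chain_certificate`**: by `prod_le_of_power_certificate` (tensorisation over the three cell budgets `∏y ≤ α₀₀^(n−1)`,
`∏k ≤ α₀₁^(n−1)`, `∏h ≤ α₁₁^(n−1)`) every nonempty family of petals satisfies `∏_j G_j ≤ g^(n−1)·a` — the two-linked-systems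
inequality (RES0′) for EVERY `n`, with no face budget, no `g`-cell budget and no shape restriction on the petals, on the parameter region
where the three kink-dwarf inequalities (Da), (Db), (Dc) hold (≈ 78 % of random parameter points with the leaf-leaf constant; memo §2).
The explicit form of the exponents is in `…SunflowerChainCertificateExplicit`. [this work]
-/

namespace Summit.CriticalPhenomena.PercolationContinuityZ3.Theorems.SunflowerPartition.SafeCalc.LinkedCurrency

section Chain

variable {τ σ s α00 α01 α11 c0 g ly lk lh : ℝ}

/- The standing hypotheses of the chain certificate (parameters, the three chain equations, the three kink-dwarf inequalities),
bundled so that every lemma of the vertex reduction takes the same argument. -/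
variable (hH : 0 < τ ∧ τ < 1 ∧ 0 ≤ σ ∧ σ < 1 ∧ 0 ≤ s ∧ s ≤ 1 ∧ 0 < α00 ∧ α00 ≤ α01 ∧ α01 ≤ α11 ∧ α11 ≤ 1 ∧ τ * σ ≤ c0 ∧
      g = (c0 + τ * (1 - σ) * ((1 - s) * α00 + s * α01) + s * (1 - τ) * ((1 - σ) * α01 + σ * α11)) ∧
      (c0 + τ * (1 - σ) * ((1 - s) * α00 + s * α01) + s * (1 - τ) * ((1 - σ) * α01 + σ * 1)) = g * (1 / α11) ^ lh ∧
      (c0 + τ * (1 - σ) * ((1 - s) * α00 + s * 1) + s * (1 - τ) * ((1 - σ) * 1 + σ * 1)) = g * (1 / α01) ^ lk * (1 / α11) ^ lh ∧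
      (c0 + τ * (1 - σ) * ((1 - s) * 1 + s * 1) + s * (1 - τ) * ((1 - σ) * 1 + σ * 1)) = g * (1 / α00) ^ ly * (1 / α01) ^ lk * (1 / α11) ^ lh ∧
      (c0 + τ * (1 - σ) * ((1 - s) * α01 + s * α01) + s * (1 - τ) * ((1 - σ) * α01 + σ * α11)) ≤ g * (α01 / α00) ^ ly ∧
      (c0 + τ * (1 - σ) * ((1 - s) * α00 + s * α11) + s * (1 - τ) * ((1 - σ) * α11 + σ * α11)) ≤ g * (α11 / α01) ^ lk ∧
      (c0 + τ * (1 - σ) * ((1 - s) * α11 + s * α11) + s * (1 - τ) * ((1 - σ) * α11 + σ * α11)) ≤ g * (α11 / α00) ^ ly * (α11 / α01) ^ lk)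

include hH

/-- Face `(α₀₀,k,k,h)`, `α₀₁ ≤ k ≤ h` (g raised to k): interpolates `chain_hedge0` and `chain_diag0`. -/
theorem chain_gk0 : ∀ h : ℝ, α11 ≤ h → h ≤ 1 → ∀ k : ℝ, α01 ≤ k → k ≤ h → (c0 + τ * (1 - σ) * ((1 - s) * α00 + s * k) + s * (1 - τ) * ((1 - σ) * k + σ * h)) ≤ g * (α00 / α00) ^ ly * (k / α01) ^ lk * (h / α11) ^ lh := by
  have hb := chain_basic hH
  obtain ⟨hτ0, hτ1, hσ0, hσ1, hs0, hs1, hα00, h01, h11, hα1, hc0, hg, Eh, EH, -, -, Db, -⟩ := id hH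
  obtain ⟨hg0, u0, u1, u2⟩ := hb
  have hα01 : 0 < α01 := lt_of_lt_of_le hα00 h01
  have hα11 : 0 < α11 := lt_of_lt_of_le hα01 h11
  have h1σ : 0 ≤ 1 - σ := sub_nonneg.2 hσ1.le
  have h1s : 0 ≤ 1 - s := sub_nonneg.2 hs1
  have h1τ : 0 ≤ 1 - τ := sub_nonneg.2 hτ1.le
  have hc0' : 0 ≤ c0 := le_trans (mul_nonneg hτ0.le hσ0) hc0
  intro h hh0 hh1 k hk0 hk1
  have hh_nn : 0 ≤ h := le_trans hα11.le hh0
  have hA : 0 ≤ (c0 + τ * (1 - σ) * ((1 - s) * α00) + s * (1 - τ) * (σ * h)) :=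
    add_nonneg (add_nonneg hc0' (mul_nonneg (mul_nonneg hτ0.le h1σ) (mul_nonneg h1s hα00.le))) (mul_nonneg (mul_nonneg hs0 h1τ) (mul_nonneg hσ0 hh_nn))
  have hB : 0 ≤ (τ * (1 - σ) * (s) + s * (1 - τ) * ((1 - σ))) :=
    add_nonneg (mul_nonneg (mul_nonneg hτ0.le h1σ) (hs0)) (mul_nonneg (mul_nonneg hs0 h1τ) (h1σ))
  have e0 : (c0 + τ * (1 - σ) * ((1 - s) * α00) + s * (1 - τ) * (σ * h)) + (τ * (1 - σ) * (s) + s * (1 - τ) * ((1 - σ))) * α01 ≤ g * (α00 / α00) ^ ly * (h / α11) ^ lh * (α01 / α01) ^ lk := by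
    have h0 : (c0 + τ * (1 - σ) * ((1 - s) * α00 + s * α01) + s * (1 - τ) * ((1 - σ) * α01 + σ * h)) ≤ g * (α00 / α00) ^ ly * (α01 / α01) ^ lk * (h / α11) ^ lh :=
      chain_hedge0 hH h hh0 hh1
    calc (c0 + τ * (1 - σ) * ((1 - s) * α00) + s * (1 - τ) * (σ * h)) + (τ * (1 - σ) * (s) + s * (1 - τ) * ((1 - σ))) * α01 = (c0 + τ * (1 - σ) * ((1 - s) * α00 + s * α01) + s * (1 - τ) * ((1 - σ) * α01 + σ * h)) := by ring
      _ ≤ g * (α00 / α00) ^ ly * (α01 / α01) ^ lk * (h / α11) ^ lh := h0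
      _ = g * (α00 / α00) ^ ly * (h / α11) ^ lh * (α01 / α01) ^ lk := by ring
  have e1 : (c0 + τ * (1 - σ) * ((1 - s) * α00) + s * (1 - τ) * (σ * h)) + (τ * (1 - σ) * (s) + s * (1 - τ) * ((1 - σ))) * h ≤ g * (α00 / α00) ^ ly * (h / α11) ^ lh * (h / α01) ^ lk := by
    have h1 : (c0 + τ * (1 - σ) * ((1 - s) * α00 + s * h) + s * (1 - τ) * ((1 - σ) * h + σ * h)) ≤ g * (α00 / α00) ^ ly * (h / α01) ^ lk * (h / α11) ^ lh :=
      chain_diag0 hH h hh0 hh1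
    calc (c0 + τ * (1 - σ) * ((1 - s) * α00) + s * (1 - τ) * (σ * h)) + (τ * (1 - σ) * (s) + s * (1 - τ) * ((1 - σ))) * h = (c0 + τ * (1 - σ) * ((1 - s) * α00 + s * h) + s * (1 - τ) * ((1 - σ) * h + σ * h)) := by ring
      _ ≤ g * (α00 / α00) ^ ly * (h / α01) ^ lk * (h / α11) ^ lh := h1
      _ = g * (α00 / α00) ^ ly * (h / α11) ^ lh * (h / α01) ^ lk := by ring
  have key : (c0 + τ * (1 - σ) * ((1 - s) * α00) + s * (1 - τ) * (σ * h)) + (τ * (1 - σ) * (s) + s * (1 - τ) * ((1 - σ))) * k ≤ g * (α00 / α00) ^ ly * (h / α11) ^ lh * (k / α01) ^ lk :=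
    affine_le_mul_rpow_of_endpoints₁ hA hB hα01 hα01 hk0 hk1 e0 e1
  calc (c0 + τ * (1 - σ) * ((1 - s) * α00 + s * k) + s * (1 - τ) * ((1 - σ) * k + σ * h)) = (c0 + τ * (1 - σ) * ((1 - s) * α00) + s * (1 - τ) * (σ * h)) + (τ * (1 - σ) * (s) + s * (1 - τ) * ((1 - σ))) * k := by ring
    _ ≤ g * (α00 / α00) ^ ly * (h / α11) ^ lh * (k / α01) ^ lk := key
    _ = g * (α00 / α00) ^ ly * (k / α01) ^ lk * (h / α11) ^ lh := by ring

/-- Face `(k,k,k,h)`, `α₀₁ ≤ k ≤ h`: interpolates `chain_hedge1` and `chain_diag1`. -/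
theorem chain_gk1 : ∀ h : ℝ, α11 ≤ h → h ≤ 1 → ∀ k : ℝ, α01 ≤ k → k ≤ h → (c0 + τ * (1 - σ) * ((1 - s) * k + s * k) + s * (1 - τ) * ((1 - σ) * k + σ * h)) ≤ g * (k / α00) ^ ly * (k / α01) ^ lk * (h / α11) ^ lh := by
  have hb := chain_basic hH
  obtain ⟨hτ0, hτ1, hσ0, hσ1, hs0, hs1, hα00, h01, h11, hα1, hc0, hg, Eh, -, Ef, Da, -, Dc⟩ := id hH
  obtain ⟨hg0, u0, u1, u2⟩ := hb
  have hα01 : 0 < α01 := lt_of_lt_of_le hα00 h01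
  have hα11 : 0 < α11 := lt_of_lt_of_le hα01 h11
  have h1σ : 0 ≤ 1 - σ := sub_nonneg.2 hσ1.le
  have h1s : 0 ≤ 1 - s := sub_nonneg.2 hs1
  have h1τ : 0 ≤ 1 - τ := sub_nonneg.2 hτ1.le
  have hc0' : 0 ≤ c0 := le_trans (mul_nonneg hτ0.le hσ0) hc0
  intro h hh0 hh1 k hk0 hk1
  have hh_nn : 0 ≤ h := le_trans hα11.le hh0
  have hA : 0 ≤ (c0 + τ * (1 - σ) * (0) + s * (1 - τ) * (σ * h)) :=
    add_nonneg (add_nonneg hc0' (mul_nonneg (mul_nonneg hτ0.le h1σ) (le_refl 0))) (mul_nonneg (mul_nonneg hs0 h1τ) (mul_nonneg hσ0 hh_nn))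
  have hB : 0 ≤ (τ * (1 - σ) * ((1 - s) + s) + s * (1 - τ) * ((1 - σ))) :=
    add_nonneg (mul_nonneg (mul_nonneg hτ0.le h1σ) ((by rw [show (1 - s) + s = (1:ℝ) by ring]; exact zero_le_one))) (mul_nonneg (mul_nonneg hs0 h1τ) (h1σ))
  have e0 : (c0 + τ * (1 - σ) * (0) + s * (1 - τ) * (σ * h)) + (τ * (1 - σ) * ((1 - s) + s) + s * (1 - τ) * ((1 - σ))) * α01 ≤ g * (h / α11) ^ lh * (α01 / α00) ^ ly * (α01 / α01) ^ lk := by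
    have h0 : (c0 + τ * (1 - σ) * ((1 - s) * α01 + s * α01) + s * (1 - τ) * ((1 - σ) * α01 + σ * h)) ≤ g * (α01 / α00) ^ ly * (α01 / α01) ^ lk * (h / α11) ^ lh :=
      chain_hedge1 hH h hh0 hh1
    calc (c0 + τ * (1 - σ) * (0) + s * (1 - τ) * (σ * h)) + (τ * (1 - σ) * ((1 - s) + s) + s * (1 - τ) * ((1 - σ))) * α01 = (c0 + τ * (1 - σ) * ((1 - s) * α01 + s * α01) + s * (1 - τ) * ((1 - σ) * α01 + σ * h)) := by ring
      _ ≤ g * (α01 / α00) ^ ly * (α01 / α01) ^ lk * (h / α11) ^ lh := h0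
      _ = g * (h / α11) ^ lh * (α01 / α00) ^ ly * (α01 / α01) ^ lk := by ring
  have e1 : (c0 + τ * (1 - σ) * (0) + s * (1 - τ) * (σ * h)) + (τ * (1 - σ) * ((1 - s) + s) + s * (1 - τ) * ((1 - σ))) * h ≤ g * (h / α11) ^ lh * (h / α00) ^ ly * (h / α01) ^ lk := by
    have h1 : (c0 + τ * (1 - σ) * ((1 - s) * h + s * h) + s * (1 - τ) * ((1 - σ) * h + σ * h)) ≤ g * (h / α00) ^ ly * (h / α01) ^ lk * (h / α11) ^ lh :=
      chain_diag1 hH h hh0 hh1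
    calc (c0 + τ * (1 - σ) * (0) + s * (1 - τ) * (σ * h)) + (τ * (1 - σ) * ((1 - s) + s) + s * (1 - τ) * ((1 - σ))) * h = (c0 + τ * (1 - σ) * ((1 - s) * h + s * h) + s * (1 - τ) * ((1 - σ) * h + σ * h)) := by ring
      _ ≤ g * (h / α00) ^ ly * (h / α01) ^ lk * (h / α11) ^ lh := h1
      _ = g * (h / α11) ^ lh * (h / α00) ^ ly * (h / α01) ^ lk := by ring
  have key : (c0 + τ * (1 - σ) * (0) + s * (1 - τ) * (σ * h)) + (τ * (1 - σ) * ((1 - s) + s) + s * (1 - τ) * ((1 - σ))) * k ≤ g * (h / α11) ^ lh * (k / α00) ^ ly * (k / α01) ^ lk :=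
    affine_le_mul_rpow_of_endpoints₂ hA hB hα00 hα01 hα01 hk0 hk1 e0 e1
  calc (c0 + τ * (1 - σ) * ((1 - s) * k + s * k) + s * (1 - τ) * ((1 - σ) * k + σ * h)) = (c0 + τ * (1 - σ) * (0) + s * (1 - τ) * (σ * h)) + (τ * (1 - σ) * ((1 - s) + s) + s * (1 - τ) * ((1 - σ))) * k := by ring
    _ ≤ g * (h / α11) ^ lh * (k / α00) ^ ly * (k / α01) ^ lk := key
    _ = g * (k / α00) ^ ly * (k / α01) ^ lk * (h / α11) ^ lh := by ring

/-- Face `(α₀₀,k,h,h)`, `α₁₁ ≤ h ≤ k` (g raised to h): interpolates `chain_kedge0` and `chain_diag0`. -/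
theorem chain_gh0 : ∀ k : ℝ, α11 ≤ k → k ≤ 1 → ∀ h : ℝ, α11 ≤ h → h ≤ k → (c0 + τ * (1 - σ) * ((1 - s) * α00 + s * k) + s * (1 - τ) * ((1 - σ) * h + σ * h)) ≤ g * (α00 / α00) ^ ly * (k / α01) ^ lk * (h / α11) ^ lh := by
  have hb := chain_basic hH
  obtain ⟨hτ0, hτ1, hσ0, hσ1, hs0, hs1, hα00, h01, h11, hα1, hc0, hg, Eh, EH, -, -, Db, -⟩ := id hH
  obtain ⟨hg0, u0, u1, u2⟩ := hb
  have hα01 : 0 < α01 := lt_of_lt_of_le hα00 h01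
  have hα11 : 0 < α11 := lt_of_lt_of_le hα01 h11
  have h1σ : 0 ≤ 1 - σ := sub_nonneg.2 hσ1.le
  have h1s : 0 ≤ 1 - s := sub_nonneg.2 hs1
  have h1τ : 0 ≤ 1 - τ := sub_nonneg.2 hτ1.le
  have hc0' : 0 ≤ c0 := le_trans (mul_nonneg hτ0.le hσ0) hc0
  intro k hk0 hk1 h hh0 hh1
  have hk_nn : 0 ≤ k := le_trans hα11.le hk0
  have hA : 0 ≤ (c0 + τ * (1 - σ) * ((1 - s) * α00 + s * k) + s * (1 - τ) * (0)) :=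
    add_nonneg (add_nonneg hc0' (mul_nonneg (mul_nonneg hτ0.le h1σ) (add_nonneg (mul_nonneg h1s hα00.le) (mul_nonneg hs0 hk_nn)))) (mul_nonneg (mul_nonneg hs0 h1τ) (le_refl 0))
  have hB : 0 ≤ (τ * (1 - σ) * (0) + s * (1 - τ) * ((1 - σ) + σ)) :=
    add_nonneg (mul_nonneg (mul_nonneg hτ0.le h1σ) (le_refl 0)) (mul_nonneg (mul_nonneg hs0 h1τ) ((by rw [show (1 - σ) + σ = (1:ℝ) by ring]; exact zero_le_one)))
  have e0 : (c0 + τ * (1 - σ) * ((1 - s) * α00 + s * k) + s * (1 - τ) * (0)) + (τ * (1 - σ) * (0) + s * (1 - τ) * ((1 - σ) + σ)) * α11 ≤ g * (α00 / α00) ^ ly * (k / α01) ^ lk * (α11 / α11) ^ lh := by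
    have h0 : (c0 + τ * (1 - σ) * ((1 - s) * α00 + s * k) + s * (1 - τ) * ((1 - σ) * α11 + σ * α11)) ≤ g * (α00 / α00) ^ ly * (k / α01) ^ lk * (α11 / α11) ^ lh :=
      chain_kedge0 hH k hk0 hk1
    calc (c0 + τ * (1 - σ) * ((1 - s) * α00 + s * k) + s * (1 - τ) * (0)) + (τ * (1 - σ) * (0) + s * (1 - τ) * ((1 - σ) + σ)) * α11 = (c0 + τ * (1 - σ) * ((1 - s) * α00 + s * k) + s * (1 - τ) * ((1 - σ) * α11 + σ * α11)) := by ring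
      _ ≤ g * (α00 / α00) ^ ly * (k / α01) ^ lk * (α11 / α11) ^ lh := h0
      _ = g * (α00 / α00) ^ ly * (k / α01) ^ lk * (α11 / α11) ^ lh := by ring
  have e1 : (c0 + τ * (1 - σ) * ((1 - s) * α00 + s * k) + s * (1 - τ) * (0)) + (τ * (1 - σ) * (0) + s * (1 - τ) * ((1 - σ) + σ)) * k ≤ g * (α00 / α00) ^ ly * (k / α01) ^ lk * (k / α11) ^ lh := by
    have h1 : (c0 + τ * (1 - σ) * ((1 - s) * α00 + s * k) + s * (1 - τ) * ((1 - σ) * k + σ * k)) ≤ g * (α00 / α00) ^ ly * (k / α01) ^ lk * (k / α11) ^ lh :=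
      chain_diag0 hH k hk0 hk1
    calc (c0 + τ * (1 - σ) * ((1 - s) * α00 + s * k) + s * (1 - τ) * (0)) + (τ * (1 - σ) * (0) + s * (1 - τ) * ((1 - σ) + σ)) * k = (c0 + τ * (1 - σ) * ((1 - s) * α00 + s * k) + s * (1 - τ) * ((1 - σ) * k + σ * k)) := by ring
      _ ≤ g * (α00 / α00) ^ ly * (k / α01) ^ lk * (k / α11) ^ lh := h1
      _ = g * (α00 / α00) ^ ly * (k / α01) ^ lk * (k / α11) ^ lh := by ring
  have key : (c0 + τ * (1 - σ) * ((1 - s) * α00 + s * k) + s * (1 - τ) * (0)) + (τ * (1 - σ) * (0) + s * (1 - τ) * ((1 - σ) + σ)) * h ≤ g * (α00 / α00) ^ ly * (k / α01) ^ lk * (h / α11) ^ lh :=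
    affine_le_mul_rpow_of_endpoints₁ hA hB hα11 hα11 hh0 hh1 e0 e1
  calc (c0 + τ * (1 - σ) * ((1 - s) * α00 + s * k) + s * (1 - τ) * ((1 - σ) * h + σ * h)) = (c0 + τ * (1 - σ) * ((1 - s) * α00 + s * k) + s * (1 - τ) * (0)) + (τ * (1 - σ) * (0) + s * (1 - τ) * ((1 - σ) + σ)) * h := by ring
    _ ≤ g * (α00 / α00) ^ ly * (k / α01) ^ lk * (h / α11) ^ lh := key
    _ = g * (α00 / α00) ^ ly * (k / α01) ^ lk * (h / α11) ^ lh := by ring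

/-- Face `(k,k,h,h)`, `α₁₁ ≤ h ≤ k`: interpolates `chain_kedge1` and `chain_diag1`. -/
theorem chain_gh1 : ∀ k : ℝ, α11 ≤ k → k ≤ 1 → ∀ h : ℝ, α11 ≤ h → h ≤ k → (c0 + τ * (1 - σ) * ((1 - s) * k + s * k) + s * (1 - τ) * ((1 - σ) * h + σ * h)) ≤ g * (k / α00) ^ ly * (k / α01) ^ lk * (h / α11) ^ lh := by
  have hb := chain_basic hH
  obtain ⟨hτ0, hτ1, hσ0, hσ1, hs0, hs1, hα00, h01, h11, hα1, hc0, hg, Eh, -, Ef, -, -, Dc⟩ := id hH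
  obtain ⟨hg0, u0, u1, u2⟩ := hb
  have hα01 : 0 < α01 := lt_of_lt_of_le hα00 h01
  have hα11 : 0 < α11 := lt_of_lt_of_le hα01 h11
  have h1σ : 0 ≤ 1 - σ := sub_nonneg.2 hσ1.le
  have h1s : 0 ≤ 1 - s := sub_nonneg.2 hs1
  have h1τ : 0 ≤ 1 - τ := sub_nonneg.2 hτ1.le
  have hc0' : 0 ≤ c0 := le_trans (mul_nonneg hτ0.le hσ0) hc0
  intro k hk0 hk1 h hh0 hh1
  have hk_nn : 0 ≤ k := le_trans hα11.le hk0
  have hA : 0 ≤ (c0 + τ * (1 - σ) * ((1 - s) * k + s * k) + s * (1 - τ) * (0)) :=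
    add_nonneg (add_nonneg hc0' (mul_nonneg (mul_nonneg hτ0.le h1σ) (add_nonneg (mul_nonneg h1s hk_nn) (mul_nonneg hs0 hk_nn)))) (mul_nonneg (mul_nonneg hs0 h1τ) (le_refl 0))
  have hB : 0 ≤ (τ * (1 - σ) * (0) + s * (1 - τ) * ((1 - σ) + σ)) :=
    add_nonneg (mul_nonneg (mul_nonneg hτ0.le h1σ) (le_refl 0)) (mul_nonneg (mul_nonneg hs0 h1τ) ((by rw [show (1 - σ) + σ = (1:ℝ) by ring]; exact zero_le_one)))
  have e0 : (c0 + τ * (1 - σ) * ((1 - s) * k + s * k) + s * (1 - τ) * (0)) + (τ * (1 - σ) * (0) + s * (1 - τ) * ((1 - σ) + σ)) * α11 ≤ g * (k / α00) ^ ly * (k / α01) ^ lk * (α11 / α11) ^ lh := by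
    have h0 : (c0 + τ * (1 - σ) * ((1 - s) * k + s * k) + s * (1 - τ) * ((1 - σ) * α11 + σ * α11)) ≤ g * (k / α00) ^ ly * (k / α01) ^ lk * (α11 / α11) ^ lh :=
      chain_kedge1 hH k hk0 hk1
    calc (c0 + τ * (1 - σ) * ((1 - s) * k + s * k) + s * (1 - τ) * (0)) + (τ * (1 - σ) * (0) + s * (1 - τ) * ((1 - σ) + σ)) * α11 = (c0 + τ * (1 - σ) * ((1 - s) * k + s * k) + s * (1 - τ) * ((1 - σ) * α11 + σ * α11)) := by ring
      _ ≤ g * (k / α00) ^ ly * (k / α01) ^ lk * (α11 / α11) ^ lh := h0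
      _ = g * (k / α00) ^ ly * (k / α01) ^ lk * (α11 / α11) ^ lh := by ring
  have e1 : (c0 + τ * (1 - σ) * ((1 - s) * k + s * k) + s * (1 - τ) * (0)) + (τ * (1 - σ) * (0) + s * (1 - τ) * ((1 - σ) + σ)) * k ≤ g * (k / α00) ^ ly * (k / α01) ^ lk * (k / α11) ^ lh := by
    have h1 : (c0 + τ * (1 - σ) * ((1 - s) * k + s * k) + s * (1 - τ) * ((1 - σ) * k + σ * k)) ≤ g * (k / α00) ^ ly * (k / α01) ^ lk * (k / α11) ^ lh :=
      chain_diag1 hH k hk0 hk1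
    calc (c0 + τ * (1 - σ) * ((1 - s) * k + s * k) + s * (1 - τ) * (0)) + (τ * (1 - σ) * (0) + s * (1 - τ) * ((1 - σ) + σ)) * k = (c0 + τ * (1 - σ) * ((1 - s) * k + s * k) + s * (1 - τ) * ((1 - σ) * k + σ * k)) := by ring
      _ ≤ g * (k / α00) ^ ly * (k / α01) ^ lk * (k / α11) ^ lh := h1
      _ = g * (k / α00) ^ ly * (k / α01) ^ lk * (k / α11) ^ lh := by ring
  have key : (c0 + τ * (1 - σ) * ((1 - s) * k + s * k) + s * (1 - τ) * (0)) + (τ * (1 - σ) * (0) + s * (1 - τ) * ((1 - σ) + σ)) * h ≤ g * (k / α00) ^ ly * (k / α01) ^ lk * (h / α11) ^ lh :=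
    affine_le_mul_rpow_of_endpoints₁ hA hB hα11 hα11 hh0 hh1 e0 e1
  calc (c0 + τ * (1 - σ) * ((1 - s) * k + s * k) + s * (1 - τ) * ((1 - σ) * h + σ * h)) = (c0 + τ * (1 - σ) * ((1 - s) * k + s * k) + s * (1 - τ) * (0)) + (τ * (1 - σ) * (0) + s * (1 - τ) * ((1 - σ) + σ)) * h := by ring
    _ ≤ g * (k / α00) ^ ly * (k / α01) ^ lk * (h / α11) ^ lh := key
    _ = g * (k / α00) ^ ly * (k / α01) ^ lk * (h / α11) ^ lh := by ring

/-- Region `(y,k,k,h)`, `α₀₀ ≤ y ≤ k ≤ h` (the case `g = k ≤ h` of the final theorem): interpolates `chain_gk0` and `chain_gk1` in `y`. -/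
theorem chain_y_gk : ∀ h : ℝ, α11 ≤ h → h ≤ 1 → ∀ k : ℝ, α01 ≤ k → k ≤ h → ∀ y : ℝ, α00 ≤ y → y ≤ k → (c0 + τ * (1 - σ) * ((1 - s) * y + s * k) + s * (1 - τ) * ((1 - σ) * k + σ * h)) ≤ g * (y / α00) ^ ly * (k / α01) ^ lk * (h / α11) ^ lh := by
  have hb := chain_basic hH
  obtain ⟨hτ0, hτ1, hσ0, hσ1, hs0, hs1, hα00, h01, h11, hα1, hc0, hg, Eh, EH, Ef, Da, Db, Dc⟩ := id hH
  obtain ⟨hg0, u0, u1, u2⟩ := hb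
  have hα01 : 0 < α01 := lt_of_lt_of_le hα00 h01
  have hα11 : 0 < α11 := lt_of_lt_of_le hα01 h11
  have h1σ : 0 ≤ 1 - σ := sub_nonneg.2 hσ1.le
  have h1s : 0 ≤ 1 - s := sub_nonneg.2 hs1
  have h1τ : 0 ≤ 1 - τ := sub_nonneg.2 hτ1.le
  have hc0' : 0 ≤ c0 := le_trans (mul_nonneg hτ0.le hσ0) hc0
  intro h hh0 hh1 k hk0 hk1 y hy0 hy1
  have hh_nn : 0 ≤ h := le_trans hα11.le hh0
  have hk_nn : 0 ≤ k := le_trans hα01.le hk0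
  have hA : 0 ≤ (c0 + τ * (1 - σ) * (s * k) + s * (1 - τ) * ((1 - σ) * k + σ * h)) :=
    add_nonneg (add_nonneg hc0' (mul_nonneg (mul_nonneg hτ0.le h1σ) (mul_nonneg hs0 hk_nn))) (mul_nonneg (mul_nonneg hs0 h1τ) (add_nonneg (mul_nonneg h1σ hk_nn) (mul_nonneg hσ0 hh_nn)))
  have hB : 0 ≤ (τ * (1 - σ) * ((1 - s)) + s * (1 - τ) * (0)) :=
    add_nonneg (mul_nonneg (mul_nonneg hτ0.le h1σ) (h1s)) (mul_nonneg (mul_nonneg hs0 h1τ) (le_refl 0))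
  have e0 : (c0 + τ * (1 - σ) * (s * k) + s * (1 - τ) * ((1 - σ) * k + σ * h)) + (τ * (1 - σ) * ((1 - s)) + s * (1 - τ) * (0)) * α00 ≤ g * (k / α01) ^ lk * (h / α11) ^ lh * (α00 / α00) ^ ly := by
    have h0 : (c0 + τ * (1 - σ) * ((1 - s) * α00 + s * k) + s * (1 - τ) * ((1 - σ) * k + σ * h)) ≤ g * (α00 / α00) ^ ly * (k / α01) ^ lk * (h / α11) ^ lh :=
      chain_gk0 hH h hh0 hh1 k hk0 hk1
    calc (c0 + τ * (1 - σ) * (s * k) + s * (1 - τ) * ((1 - σ) * k + σ * h)) + (τ * (1 - σ) * ((1 - s)) + s * (1 - τ) * (0)) * α00 = (c0 + τ * (1 - σ) * ((1 - s) * α00 + s * k) + s * (1 - τ) * ((1 - σ) * k + σ * h)) := by ring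
      _ ≤ g * (α00 / α00) ^ ly * (k / α01) ^ lk * (h / α11) ^ lh := h0
      _ = g * (k / α01) ^ lk * (h / α11) ^ lh * (α00 / α00) ^ ly := by ring
  have e1 : (c0 + τ * (1 - σ) * (s * k) + s * (1 - τ) * ((1 - σ) * k + σ * h)) + (τ * (1 - σ) * ((1 - s)) + s * (1 - τ) * (0)) * k ≤ g * (k / α01) ^ lk * (h / α11) ^ lh * (k / α00) ^ ly := by
    have h1 : (c0 + τ * (1 - σ) * ((1 - s) * k + s * k) + s * (1 - τ) * ((1 - σ) * k + σ * h)) ≤ g * (k / α00) ^ ly * (k / α01) ^ lk * (h / α11) ^ lh :=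
      chain_gk1 hH h hh0 hh1 k hk0 hk1
    calc (c0 + τ * (1 - σ) * (s * k) + s * (1 - τ) * ((1 - σ) * k + σ * h)) + (τ * (1 - σ) * ((1 - s)) + s * (1 - τ) * (0)) * k = (c0 + τ * (1 - σ) * ((1 - s) * k + s * k) + s * (1 - τ) * ((1 - σ) * k + σ * h)) := by ring
      _ ≤ g * (k / α00) ^ ly * (k / α01) ^ lk * (h / α11) ^ lh := h1
      _ = g * (k / α01) ^ lk * (h / α11) ^ lh * (k / α00) ^ ly := by ring
  have key : (c0 + τ * (1 - σ) * (s * k) + s * (1 - τ) * ((1 - σ) * k + σ * h)) + (τ * (1 - σ) * ((1 - s)) + s * (1 - τ) * (0)) * y ≤ g * (k / α01) ^ lk * (h / α11) ^ lh * (y / α00) ^ ly :=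
    affine_le_mul_rpow_of_endpoints₁ hA hB hα00 hα00 hy0 hy1 e0 e1
  calc (c0 + τ * (1 - σ) * ((1 - s) * y + s * k) + s * (1 - τ) * ((1 - σ) * k + σ * h)) = (c0 + τ * (1 - σ) * (s * k) + s * (1 - τ) * ((1 - σ) * k + σ * h)) + (τ * (1 - σ) * ((1 - s)) + s * (1 - τ) * (0)) * y := by ring
    _ ≤ g * (k / α01) ^ lk * (h / α11) ^ lh * (y / α00) ^ ly := key
    _ = g * (y / α00) ^ ly * (k / α01) ^ lk * (h / α11) ^ lh := by ring

/-- Region `(y,k,h,h)`, `α₀₀ ≤ y ≤ k`, `α₁₁ ≤ h ≤ k` (the case `g = h ≤ k`): interpolates `chain_gh0` and `chain_gh1` in `y`. -/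
theorem chain_y_gh : ∀ k : ℝ, α11 ≤ k → k ≤ 1 → ∀ h : ℝ, α11 ≤ h → h ≤ k → ∀ y : ℝ, α00 ≤ y → y ≤ k → (c0 + τ * (1 - σ) * ((1 - s) * y + s * k) + s * (1 - τ) * ((1 - σ) * h + σ * h)) ≤ g * (y / α00) ^ ly * (k / α01) ^ lk * (h / α11) ^ lh := by
  have hb := chain_basic hH
  obtain ⟨hτ0, hτ1, hσ0, hσ1, hs0, hs1, hα00, h01, h11, hα1, hc0, hg, Eh, EH, Ef, -, Db, Dc⟩ := id hH
  obtain ⟨hg0, u0, u1, u2⟩ := hb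
  have hα01 : 0 < α01 := lt_of_lt_of_le hα00 h01
  have hα11 : 0 < α11 := lt_of_lt_of_le hα01 h11
  have h1σ : 0 ≤ 1 - σ := sub_nonneg.2 hσ1.le
  have h1s : 0 ≤ 1 - s := sub_nonneg.2 hs1
  have h1τ : 0 ≤ 1 - τ := sub_nonneg.2 hτ1.le
  have hc0' : 0 ≤ c0 := le_trans (mul_nonneg hτ0.le hσ0) hc0
  intro k hk0 hk1 h hh0 hh1 y hy0 hy1
  have hh_nn : 0 ≤ h := le_trans hα11.le hh0
  have hk_nn : 0 ≤ k := le_trans hα11.le hk0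
  have hA : 0 ≤ (c0 + τ * (1 - σ) * (s * k) + s * (1 - τ) * ((1 - σ) * h + σ * h)) :=
    add_nonneg (add_nonneg hc0' (mul_nonneg (mul_nonneg hτ0.le h1σ) (mul_nonneg hs0 hk_nn))) (mul_nonneg (mul_nonneg hs0 h1τ) (add_nonneg (mul_nonneg h1σ hh_nn) (mul_nonneg hσ0 hh_nn)))
  have hB : 0 ≤ (τ * (1 - σ) * ((1 - s)) + s * (1 - τ) * (0)) :=
    add_nonneg (mul_nonneg (mul_nonneg hτ0.le h1σ) (h1s)) (mul_nonneg (mul_nonneg hs0 h1τ) (le_refl 0))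
  have e0 : (c0 + τ * (1 - σ) * (s * k) + s * (1 - τ) * ((1 - σ) * h + σ * h)) + (τ * (1 - σ) * ((1 - s)) + s * (1 - τ) * (0)) * α00 ≤ g * (k / α01) ^ lk * (h / α11) ^ lh * (α00 / α00) ^ ly := by
    have h0 : (c0 + τ * (1 - σ) * ((1 - s) * α00 + s * k) + s * (1 - τ) * ((1 - σ) * h + σ * h)) ≤ g * (α00 / α00) ^ ly * (k / α01) ^ lk * (h / α11) ^ lh :=
      chain_gh0 hH k hk0 hk1 h hh0 hh1
    calc (c0 + τ * (1 - σ) * (s * k) + s * (1 - τ) * ((1 - σ) * h + σ * h)) + (τ * (1 - σ) * ((1 - s)) + s * (1 - τ) * (0)) * α00 = (c0 + τ * (1 - σ) * ((1 - s) * α00 + s * k) + s * (1 - τ) * ((1 - σ) * h + σ * h)) := by ring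
      _ ≤ g * (α00 / α00) ^ ly * (k / α01) ^ lk * (h / α11) ^ lh := h0
      _ = g * (k / α01) ^ lk * (h / α11) ^ lh * (α00 / α00) ^ ly := by ring
  have e1 : (c0 + τ * (1 - σ) * (s * k) + s * (1 - τ) * ((1 - σ) * h + σ * h)) + (τ * (1 - σ) * ((1 - s)) + s * (1 - τ) * (0)) * k ≤ g * (k / α01) ^ lk * (h / α11) ^ lh * (k / α00) ^ ly := by
    have h1 : (c0 + τ * (1 - σ) * ((1 - s) * k + s * k) + s * (1 - τ) * ((1 - σ) * h + σ * h)) ≤ g * (k / α00) ^ ly * (k / α01) ^ lk * (h / α11) ^ lh :=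
      chain_gh1 hH k hk0 hk1 h hh0 hh1
    calc (c0 + τ * (1 - σ) * (s * k) + s * (1 - τ) * ((1 - σ) * h + σ * h)) + (τ * (1 - σ) * ((1 - s)) + s * (1 - τ) * (0)) * k = (c0 + τ * (1 - σ) * ((1 - s) * k + s * k) + s * (1 - τ) * ((1 - σ) * h + σ * h)) := by ring
      _ ≤ g * (k / α00) ^ ly * (k / α01) ^ lk * (h / α11) ^ lh := h1
      _ = g * (k / α01) ^ lk * (h / α11) ^ lh * (k / α00) ^ ly := by ring
  have key : (c0 + τ * (1 - σ) * (s * k) + s * (1 - τ) * ((1 - σ) * h + σ * h)) + (τ * (1 - σ) * ((1 - s)) + s * (1 - τ) * (0)) * y ≤ g * (k / α01) ^ lk * (h / α11) ^ lh * (y / α00) ^ ly :=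
    affine_le_mul_rpow_of_endpoints₁ hA hB hα00 hα00 hy0 hy1 e0 e1
  calc (c0 + τ * (1 - σ) * ((1 - s) * y + s * k) + s * (1 - τ) * ((1 - σ) * h + σ * h)) = (c0 + τ * (1 - σ) * (s * k) + s * (1 - τ) * ((1 - σ) * h + σ * h)) + (τ * (1 - σ) * ((1 - s)) + s * (1 - τ) * (0)) * y := by ring
    _ ≤ g * (k / α01) ^ lk * (h / α11) ^ lh * (y / α00) ^ ly := key
    _ = g * (y / α00) ^ ly * (k / α01) ^ lk * (h / α11) ^ lh := by ring

/-- **THE CHAIN CERTIFICATE, ONE-PETAL FORM.**  Under the standing hypotheses (parameters with `c₀ ≥ τσ`, the three chain equations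
defining `λ_y, λ_k, λ_h`, and the three kink-dwarf inequalities (Da), (Db), (Dc)) every petal of the (RES0′) model satisfies
`G(y,k,g,h) ≤ g·(y/α₀₀)^λ_y·(k/α₀₁)^λ_k·(h/α₁₁)^λ_h`. [this work] -/
theorem chain_one_petal_of : ∀ y k gc h : ℝ, α00 ≤ y → y ≤ k → k ≤ 1 → α01 ≤ gc → gc ≤ k → gc ≤ h → α11 ≤ h → h ≤ 1 →
    (c0 + τ * (1 - σ) * ((1 - s) * y + s * k) + s * (1 - τ) * ((1 - σ) * gc + σ * h)) ≤ g * (y / α00) ^ ly * (k / α01) ^ lk * (h / α11) ^ lh := by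
  obtain ⟨-, hτ1, -, hσ1, hs0, -, -, -, -, -, -, -, -, -, -, -, -, -⟩ := id hH
  have h1σ : 0 ≤ 1 - σ := sub_nonneg.2 hσ1.le
  have h1τ : 0 ≤ 1 - τ := sub_nonneg.2 hτ1.le
  intro y k gc h hy0 hyk hk1 hg0 hgk hgh hh0 hh1
  rcases le_total k h with hkh | hhk
  · have mono : (c0 + τ * (1 - σ) * ((1 - s) * y + s * k) + s * (1 - τ) * ((1 - σ) * gc + σ * h)) ≤ (c0 + τ * (1 - σ) * ((1 - s) * y + s * k) + s * (1 - τ) * ((1 - σ) * k + σ * h)) := by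
      have idm : (c0 + τ * (1 - σ) * ((1 - s) * y + s * k) + s * (1 - τ) * ((1 - σ) * k + σ * h)) - (c0 + τ * (1 - σ) * ((1 - s) * y + s * k) + s * (1 - τ) * ((1 - σ) * gc + σ * h)) = s * (1 - τ) * (1 - σ) * (k - gc) := by ring
      linarith only [mul_nonneg (mul_nonneg (mul_nonneg hs0 h1τ) h1σ) (sub_nonneg.2 hgk), idm]
    exact le_trans mono (chain_y_gk hH h hh0 hh1 k (le_trans hg0 hgk) hkh y hy0 hyk)
  · have mono : (c0 + τ * (1 - σ) * ((1 - s) * y + s * k) + s * (1 - τ) * ((1 - σ) * gc + σ * h)) ≤ (c0 + τ * (1 - σ) * ((1 - s) * y + s * k) + s * (1 - τ) * ((1 - σ) * h + σ * h)) := by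
      have idm : (c0 + τ * (1 - σ) * ((1 - s) * y + s * k) + s * (1 - τ) * ((1 - σ) * h + σ * h)) - (c0 + τ * (1 - σ) * ((1 - s) * y + s * k) + s * (1 - τ) * ((1 - σ) * gc + σ * h)) = s * (1 - τ) * (1 - σ) * (h - gc) := by ring
      linarith only [mul_nonneg (mul_nonneg (mul_nonneg hs0 h1τ) h1σ) (sub_nonneg.2 hgh), idm]
    exact le_trans mono (chain_y_gh hH k (le_trans hh0 hhk) hk1 h hh0 hhk y hy0 hyk)

end Chain



open Finset

set_option maxHeartbeats 800000 in
/-- **(RES0′) for every number of petals from the chain certificate** (see the module docstring). [this work] -/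
theorem res0_of_chain_certificate {κ : Type*} [DecidableEq κ] {τ σ s α00 α01 α11 c0 ly lk lh : ℝ} (hτ0 : 0 < τ) (hτ1 : τ < 1)
    (hσ0 : 0 ≤ σ) (hσ1 : σ < 1) (hs0 : 0 ≤ s) (hs1 : s ≤ 1) (hα00 : 0 < α00) (h01 : α00 ≤ α01) (h11 : α01 ≤ α11) (hα1 : α11 ≤ 1)
    (hc0 : τ * σ ≤ c0) (hly : 0 ≤ ly) (hlk : 0 ≤ lk) (hlh : 0 ≤ lh)
    (Eh : (c0 + τ * (1 - σ) * ((1 - s) * α00 + s * α01) + s * (1 - τ) * ((1 - σ) * α01 + σ * 1)) = (c0 + τ * (1 - σ) * ((1 - s) * α00 + s * α01) + s * (1 - τ) * ((1 - σ) * α01 + σ * α11)) * (1 / α11) ^ lh)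
    (EH : (c0 + τ * (1 - σ) * ((1 - s) * α00 + s * 1) + s * (1 - τ) * ((1 - σ) * 1 + σ * 1)) = (c0 + τ * (1 - σ) * ((1 - s) * α00 + s * α01) + s * (1 - τ) * ((1 - σ) * α01 + σ * α11)) * (1 / α01) ^ lk * (1 / α11) ^ lh)
    (Ef : (c0 + τ * (1 - σ) * ((1 - s) * 1 + s * 1) + s * (1 - τ) * ((1 - σ) * 1 + σ * 1)) = (c0 + τ * (1 - σ) * ((1 - s) * α00 + s * α01) + s * (1 - τ) * ((1 - σ) * α01 + σ * α11)) * (1 / α00) ^ ly * (1 / α01) ^ lk * (1 / α11) ^ lh)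
    (Da : (c0 + τ * (1 - σ) * ((1 - s) * α01 + s * α01) + s * (1 - τ) * ((1 - σ) * α01 + σ * α11)) ≤ (c0 + τ * (1 - σ) * ((1 - s) * α00 + s * α01) + s * (1 - τ) * ((1 - σ) * α01 + σ * α11)) * (α01 / α00) ^ ly)
    (Db : (c0 + τ * (1 - σ) * ((1 - s) * α00 + s * α11) + s * (1 - τ) * ((1 - σ) * α11 + σ * α11)) ≤ (c0 + τ * (1 - σ) * ((1 - s) * α00 + s * α01) + s * (1 - τ) * ((1 - σ) * α01 + σ * α11)) * (α11 / α01) ^ lk)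
    (Dc : (c0 + τ * (1 - σ) * ((1 - s) * α11 + s * α11) + s * (1 - τ) * ((1 - σ) * α11 + σ * α11)) ≤ (c0 + τ * (1 - σ) * ((1 - s) * α00 + s * α01) + s * (1 - τ) * ((1 - σ) * α01 + σ * α11)) * (α11 / α00) ^ ly * (α11 / α01) ^ lk)
    (S : Finset κ) (hS : S.Nonempty) (y k gc h : κ → ℝ)
    (hy : ∀ j ∈ S, α00 ≤ y j) (hyk : ∀ j ∈ S, y j ≤ k j) (hk1 : ∀ j ∈ S, k j ≤ 1) (hg : ∀ j ∈ S, α01 ≤ gc j)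
    (hgk : ∀ j ∈ S, gc j ≤ k j) (hgh : ∀ j ∈ S, gc j ≤ h j) (hh : ∀ j ∈ S, α11 ≤ h j) (hh1 : ∀ j ∈ S, h j ≤ 1)
    (hBy : ∏ j ∈ S, y j ≤ α00 ^ (S.card - 1)) (hBk : ∏ j ∈ S, k j ≤ α01 ^ (S.card - 1)) (hBh : ∏ j ∈ S, h j ≤ α11 ^ (S.card - 1)) :
    ∏ j ∈ S, (c0 + τ * (1 - σ) * ((1 - s) * y j + s * k j) + s * (1 - τ) * ((1 - σ) * gc j + σ * h j)) ≤ (c0 + τ * (1 - σ) * ((1 - s) * α00 + s * α01) + s * (1 - τ) * ((1 - σ) * α01 + σ * α11)) ^ (S.card - 1) * (c0 + τ * (1 - σ) * ((1 - s) * 1 + s * 1) + s * (1 - τ) * ((1 - σ) * 1 + σ * 1)) := by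
  have hα01 : 0 < α01 := lt_of_lt_of_le hα00 h01
  have hα11 : 0 < α11 := lt_of_lt_of_le hα01 h11
  -- the bundled hypotheses of the one-petal theorem, with `g` the literal floor value
  have hH : 0 < τ ∧ τ < 1 ∧ 0 ≤ σ ∧ σ < 1 ∧ 0 ≤ s ∧ s ≤ 1 ∧ 0 < α00 ∧ α00 ≤ α01 ∧ α01 ≤ α11 ∧ α11 ≤ 1 ∧ τ * σ ≤ c0 ∧
      (c0 + τ * (1 - σ) * ((1 - s) * α00 + s * α01) + s * (1 - τ) * ((1 - σ) * α01 + σ * α11)) = (c0 + τ * (1 - σ) * ((1 - s) * α00 + s * α01) + s * (1 - τ) * ((1 - σ) * α01 + σ * α11)) ∧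
      (c0 + τ * (1 - σ) * ((1 - s) * α00 + s * α01) + s * (1 - τ) * ((1 - σ) * α01 + σ * 1)) = (c0 + τ * (1 - σ) * ((1 - s) * α00 + s * α01) + s * (1 - τ) * ((1 - σ) * α01 + σ * α11)) * (1 / α11) ^ lh ∧
      (c0 + τ * (1 - σ) * ((1 - s) * α00 + s * 1) + s * (1 - τ) * ((1 - σ) * 1 + σ * 1)) = (c0 + τ * (1 - σ) * ((1 - s) * α00 + s * α01) + s * (1 - τ) * ((1 - σ) * α01 + σ * α11)) * (1 / α01) ^ lk * (1 / α11) ^ lh ∧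
      (c0 + τ * (1 - σ) * ((1 - s) * 1 + s * 1) + s * (1 - τ) * ((1 - σ) * 1 + σ * 1)) = (c0 + τ * (1 - σ) * ((1 - s) * α00 + s * α01) + s * (1 - τ) * ((1 - σ) * α01 + σ * α11)) * (1 / α00) ^ ly * (1 / α01) ^ lk * (1 / α11) ^ lh ∧
      (c0 + τ * (1 - σ) * ((1 - s) * α01 + s * α01) + s * (1 - τ) * ((1 - σ) * α01 + σ * α11)) ≤ (c0 + τ * (1 - σ) * ((1 - s) * α00 + s * α01) + s * (1 - τ) * ((1 - σ) * α01 + σ * α11)) * (α01 / α00) ^ ly ∧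
      (c0 + τ * (1 - σ) * ((1 - s) * α00 + s * α11) + s * (1 - τ) * ((1 - σ) * α11 + σ * α11)) ≤ (c0 + τ * (1 - σ) * ((1 - s) * α00 + s * α01) + s * (1 - τ) * ((1 - σ) * α01 + σ * α11)) * (α11 / α01) ^ lk ∧
      (c0 + τ * (1 - σ) * ((1 - s) * α11 + s * α11) + s * (1 - τ) * ((1 - σ) * α11 + σ * α11)) ≤ (c0 + τ * (1 - σ) * ((1 - s) * α00 + s * α01) + s * (1 - τ) * ((1 - σ) * α01 + σ * α11)) * (α11 / α00) ^ ly * (α11 / α01) ^ lk :=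
    ⟨hτ0, hτ1, hσ0, hσ1, hs0, hs1, hα00, h01, h11, hα1, hc0, rfl, Eh, EH, Ef, Da, Db, Dc⟩
  have hg0 : 0 < (c0 + τ * (1 - σ) * ((1 - s) * α00 + s * α01) + s * (1 - τ) * ((1 - σ) * α01 + σ * α11)) := (chain_basic hH).1
  obtain ⟨g, hgdef⟩ : ∃ t : ℝ, t = (c0 + τ * (1 - σ) * ((1 - s) * α00 + s * α01) + s * (1 - τ) * ((1 - σ) * α01 + σ * α11)) := ⟨_, rfl⟩
  have hone := chain_one_petal_of hH
  rw [← hgdef] at hg0 hone Ef ⊢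
  obtain ⟨n, hn⟩ : ∃ n, n = S.card := ⟨_, rfl⟩
  rw [← hn] at hBy hBk hBh ⊢
  have hcardS : S.card = n := hn.symm
  -- usages, caps, exponents as `Fin 3`-vectors
  have hu1 : ∀ j ∈ S, ∀ i ∈ (Finset.univ : Finset (Fin 3)), 1 ≤ (![y j / α00, k j / α01, h j / α11] : Fin 3 → ℝ) i := by
    intro j hj i _
    have := hy j hj; have := hyk j hj; have := hg j hj; have := hgk j hj; have := hh j hj
    fin_cases i
    · show 1 ≤ y j / α00; rw [le_div_iff₀ hα00]; linarith
    · show 1 ≤ k j / α01; rw [le_div_iff₀ hα01]; linarith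
    · show 1 ≤ h j / α11; rw [le_div_iff₀ hα11]; linarith
  have hV0 : ∀ j ∈ S, 0 ≤ (c0 + τ * (1 - σ) * ((1 - s) * y j + s * k j) + s * (1 - τ) * ((1 - σ) * gc j + σ * h j)) / g := fun j hj => by
    apply div_nonneg _ hg0.le
    have hy0 : 0 ≤ y j := hα00.le.trans (hy j hj)
    have hk0 : 0 ≤ k j := hy0.trans (hyk j hj)
    have hc0' : 0 ≤ c0 := le_trans (mul_nonneg hτ0.le hσ0) hc0
    have t1 : 0 ≤ τ * (1 - σ) * ((1 - s) * y j + s * k j) :=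
      mul_nonneg (mul_nonneg hτ0.le (sub_nonneg.2 hσ1.le)) (add_nonneg (mul_nonneg (sub_nonneg.2 hs1) hy0) (mul_nonneg hs0 hk0))
    have t2 : 0 ≤ s * (1 - τ) * ((1 - σ) * gc j + σ * h j) :=
      mul_nonneg (mul_nonneg hs0 (sub_nonneg.2 hτ1.le))
        (add_nonneg (mul_nonneg (sub_nonneg.2 hσ1.le) (hα01.le.trans (hg j hj))) (mul_nonneg hσ0 (hα11.le.trans (hh j hj))))
    exact add_nonneg (add_nonneg hc0' t1) t2
  have hcert' : ∀ j ∈ S, (c0 + τ * (1 - σ) * ((1 - s) * y j + s * k j) + s * (1 - τ) * ((1 - σ) * gc j + σ * h j)) / g ≤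
      ∏ i ∈ (Finset.univ : Finset (Fin 3)), ((![y j / α00, k j / α01, h j / α11] : Fin 3 → ℝ) i) ^ ((![ly, lk, lh] : Fin 3 → ℝ) i) := by
    intro j hj
    rw [Fin.prod_univ_three]
    show _ ≤ (y j / α00) ^ ly * (k j / α01) ^ lk * (h j / α11) ^ lh
    rw [div_le_iff₀ hg0]
    have := hone (y j) (k j) (gc j) (h j) (hy j hj) (hyk j hj) (hk1 j hj) (hg j hj) (hgk j hj) (hgh j hj) (hh j hj) (hh1 j hj)
    calc (c0 + τ * (1 - σ) * ((1 - s) * y j + s * k j) + s * (1 - τ) * ((1 - σ) * gc j + σ * h j)) ≤ g * (y j / α00) ^ ly * (k j / α01) ^ lk * (h j / α11) ^ lh := this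
      _ = (y j / α00) ^ ly * (k j / α01) ^ lk * (h j / α11) ^ lh * g := by ring
  have hn1 : 1 ≤ n := by rw [hn]; exact Finset.card_pos.2 hS
  have hpow : ∀ {b : ℝ}, 0 < b → ∀ {f : κ → ℝ}, ∏ j ∈ S, f j ≤ b ^ (n - 1) → ∏ j ∈ S, f j / b ≤ 1 / b := by
    intro b hb f hU
    rw [Finset.prod_div_distrib, Finset.prod_const, hcardS, div_le_div_iff₀ (pow_pos hb n) hb]
    have e : b ^ n = b ^ (n - 1) * b := by rw [← pow_succ]; congr 1; omega
    rw [e]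
    calc (∏ j ∈ S, f j) * b ≤ b ^ (n - 1) * b := mul_le_mul_of_nonneg_right hU hb.le
      _ = 1 * (b ^ (n - 1) * b) := by ring
  have hbudget : ∀ i ∈ (Finset.univ : Finset (Fin 3)),
      ∏ j ∈ S, (![y j / α00, k j / α01, h j / α11] : Fin 3 → ℝ) i ≤ (![1 / α00, 1 / α01, 1 / α11] : Fin 3 → ℝ) i := by
    intro i _
    fin_cases i
    · show ∏ j ∈ S, y j / α00 ≤ 1 / α00; exact hpow hα00 hBy
    · show ∏ j ∈ S, k j / α01 ≤ 1 / α01; exact hpow hα01 hBk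
    · show ∏ j ∈ S, h j / α11 ≤ 1 / α11; exact hpow hα11 hBh
  have hlam0 : ∀ i ∈ (Finset.univ : Finset (Fin 3)), 0 ≤ (![ly, lk, lh] : Fin 3 → ℝ) i := by
    intro i _; fin_cases i
    · exact hly
    · exact hlk
    · exact hlh
  have hT : ∏ i ∈ (Finset.univ : Finset (Fin 3)), ((![1 / α00, 1 / α01, 1 / α11] : Fin 3 → ℝ) i) ^ ((![ly, lk, lh] : Fin 3 → ℝ) i) ≤
      (c0 + τ * (1 - σ) * ((1 - s) * 1 + s * 1) + s * (1 - τ) * ((1 - σ) * 1 + σ * 1)) / g := by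
    rw [Fin.prod_univ_three]
    show (1 / α00) ^ ly * (1 / α01) ^ lk * (1 / α11) ^ lh ≤ _
    rw [le_div_iff₀ hg0, Ef]
    exact le_of_eq (by ring)
  have main := prod_le_of_power_certificate (Finset.univ : Finset (Fin 3)) S
    (fun j => (![y j / α00, k j / α01, h j / α11] : Fin 3 → ℝ))
    (fun j => (c0 + τ * (1 - σ) * ((1 - s) * y j + s * k j) + s * (1 - τ) * ((1 - σ) * gc j + σ * h j)) / g)
    (![1 / α00, 1 / α01, 1 / α11]) (![ly, lk, lh]) ((c0 + τ * (1 - σ) * ((1 - s) * 1 + s * 1) + s * (1 - τ) * ((1 - σ) * 1 + σ * 1)) / g)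
    hlam0 hu1 hV0 hcert' hbudget hT
  clear hcert' hbudget hT hV0 hu1 hlam0 hone hH Eh EH Da Db Dc
  have e1 : ∏ j ∈ S, (c0 + τ * (1 - σ) * ((1 - s) * y j + s * k j) + s * (1 - τ) * ((1 - σ) * gc j + σ * h j)) / g = (∏ j ∈ S, (c0 + τ * (1 - σ) * ((1 - s) * y j + s * k j) + s * (1 - τ) * ((1 - σ) * gc j + σ * h j))) / g ^ n := by
    rw [Finset.prod_div_distrib, Finset.prod_const, hcardS]
  rw [e1, div_le_div_iff₀ (pow_pos hg0 n) hg0] at main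
  have e2 : g ^ n = g ^ (n - 1) * g := by rw [← pow_succ]; congr 1; omega
  rw [e2] at main
  have fin : (∏ j ∈ S, (c0 + τ * (1 - σ) * ((1 - s) * y j + s * k j) + s * (1 - τ) * ((1 - σ) * gc j + σ * h j))) * g ≤ (g ^ (n - 1) * (c0 + τ * (1 - σ) * ((1 - s) * 1 + s * 1) + s * (1 - τ) * ((1 - σ) * 1 + σ * 1))) * g :=
    calc (∏ j ∈ S, (c0 + τ * (1 - σ) * ((1 - s) * y j + s * k j) + s * (1 - τ) * ((1 - σ) * gc j + σ * h j))) * g ≤ (c0 + τ * (1 - σ) * ((1 - s) * 1 + s * 1) + s * (1 - τ) * ((1 - σ) * 1 + σ * 1)) * (g ^ (n - 1) * g) := main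
      _ = (g ^ (n - 1) * (c0 + τ * (1 - σ) * ((1 - s) * 1 + s * 1) + s * (1 - τ) * ((1 - σ) * 1 + σ * 1))) * g := by ring
  exact le_of_mul_le_mul_right fin hg0

end Summit.CriticalPhenomena.PercolationContinuityZ3.Theorems.SunflowerPartition.SafeCalc.LinkedCurrency
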